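import Summits.BirchSwinnertonDyer.Rank1Residual.X1.GeneratorCountLayerZero
import Literature.NumberTheory.EllipticCurves.IwasawaGeneratorChangeProofs
import Literature.NumberTheory.EllipticCurves.IwasawaAlgebraPseudoNullProofs
import HarnessLib

/-!
# Route M's generator COUNT at LAYER `n`, I (the pairing): `p`-torsion classes of
# `Sel_{p^∞}(E/K_∞)` fixed by `γ^{pⁿ}` are counted by `X/(p, ω_n)X`, `ω_n = (1+T)^{pⁿ} − 1`
# (cell `b2b-bsdres`, unit `b2b-bsdres-eisenstein-p1`, gen 17; X1R0-GAPMAP §25.7 V76 (i), §26)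

HONEST FRAMING (run/shared/lean/b2b/bsd-rank1-residual/, verbatim in every file): the goal of the
cell is to DELETE the COMBINATION-SHAPED residual classes of the Birch–Swinnerton-Dyer formula for
ALL analytic-rank `≤ 1` elliptic curves over `ℚ` — "full BSD formula for every rank `≤ 1` curve in
class `C`" assembled STRICTLY from published theorems — so that the rank-`≤ 1` remainder becomes
exactly the CONSTRUCTION-SHAPED classes, which are TYPED (missing-input `Prop`s), NOT attempted.
This is not "finishing BSD". Sub-cell `b2b-bsdres-eisenstein-p1` (CLASS-OWNERS row "X1 (r = 0)"):
research route; NO CLAIM BEYOND STATED CLASSES; nothing here changes a label; nothing is booked.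
THEOREMS ONLY — no definition, no named fact, no typed input introduced, nothing about any
particular curve asserted.

## What and why

`X1/GeneratorCountLayerZero.lean` (gen 15) proved the LAYER-0 pairing: `p`-torsion `γ`-fixed classes
of `Sel_∞ = Sel_{p^∞}(E/K_∞)` are characters of `X/𝔪X`, `𝔪 = (p, T)`, so `#t ≤ #(X/𝔪X)`. Route T
and route M beyond layer `0` (X1R0-GAPMAP §14.1, §21.1 COROLLARY, §25.7 V76) count classes over the
LAYER `K_n`: those are fixed only by `Γ_n = Γ^{pⁿ}`, and the relevant quotient is `X/(p, ω_n)X` with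
`ω_n = (1+T)^{pⁿ} − 1` (`(1+T)` acts as `conj_γ`). This file is the layer-`n` pairing, for an
elliptic curve over ANY number field `K`, ANY `ℤ_p`-extension `κ`, any `γ ∈ Γ_K` and any
Pontryagin-dual datum `D` (`X = D.X`):

* §1 `toDual_one_add_X_pow_smul`: `((1+T)^k · x)(s) = x(conj_γ^k s)` (from the datum's
  `toDual_T_smul`); hence `(ω_n · x)(s) = 0` when `conj_{γ^{pⁿ}} s = s`, `(p · x)(s) = 0` when
  `p · s = 0`, and **`(I_n X)` pairs to zero** with such `s`, `I_n = (p, ω_n)`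
  (`toDual_apply_eq_zero_of_mem_layerIdeal_smul_top`).
* §2 `X/I_n X` is finite for `X` finitely generated: `𝔪^{pⁿ+1} ≤ I_n` — indeed
  `ω_n ≡ T^{pⁿ} (mod p)` (`p ∣ binom(pⁿ, k)`, `Nat.Prime.dvd_choose_pow`) — and `Λ/𝔪^m` is finite
  (tree `finite_quotient_maximalIdeal_pow`).
* §3 **`card_le_natCard_quotient_layerIdeal`: a finite family of DISTINCT `p`-torsion classes of
  `Sel_∞` fixed by `conj_{γ^{pⁿ}}` has at most `#(X/I_n X)` members**; and
  `card_le_natCard_quotient_layerIdeal_of_layerClasses`: so does every finite family of `A_n[p]`,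
  `A_n = h_n⁻¹(Sel_∞) ⊆ H¹(K_n, E[p^∞])`, when `E(K)[p] = 0` (`h_n` injective, n1011's
  `Additive.layerToInfty_injective_of_no_pTorsion`; `im h_n` is `Gal(K̄/K_n)`-fixed, tree
  `range_layerToInfty_le_layerInvariants_holds`, and `γ^{pⁿ} ∈ Gal(K̄/K_n) = κ⁻¹(pⁿℤ_p)`).

The other two layer-`n` ingredients of route T/M are NOT here: the COUNT of such classes from
Tamagawa data over `K_n` (n1011's `Additive/BudgetFromTamagawaCertificatesLayer*` produce them, but
transported without their `Γ_n`-invariance) and the layer-`n` BOUNDS (`#(X/I_n X) ≤ p^{λ + pⁿμ}`,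
Greenberg; `≤ p^{ord}`, LEMMA M at layer `n`). X1R0-GAPMAP §26 records the plan.

References: [GreenbergLNM1716] §1 p. 60 (`X/𝔪X` dual to `Sel[𝔪]`; the `Λ`-action through `Γ`),
Thm. 1.2, §3 pp. 85–86 (`A_n`, Lemma 3.1); [Washington1997] §13.2 (`ω_n`, Lemma 13.15 ff.);
X1R0-GAPMAP §14.1, §21.1, §25.7.
-/

noncomputable section

open scoped Classical

open WeierstrassCurve Literature.NumberTheory.EllipticCurves
  Literature.NumberTheory.EllipticCurves.IwasawaAlgebra IsLocalRing PowerSeries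

set_option autoImplicit false

universe u

namespace Summit.BirchSwinnertonDyer.Rank1Residual.X1.GeneratorCountLayer

/-! ## §1. The pairing at layer `n`: `(1+T)^k` acts as `conj_γ^k`; `I_n X` pairs to zero -/

section Pairing

variable {K : Type u} [Field K] [NumberField K] {W : WeierstrassCurve K} {p : ℕ} [hp : Fact p.Prime]
  {κ : ZpExtension K p} {γ : Field.absoluteGaloisGroup K} (D : W.SelmerDualData κ γ)

/-- **`((1+T)·x)(s) = x(conj_γ s)`**: `T` acts as `conj_γ − 1` (`toDual_T_smul`). [folklore] -/
theorem toDual_one_add_X_smul (x : D.X) (s : W.selmerInfty κ) :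
    D.toDual ((1 + (X : IwasawaAlgebra p)) • x) s = D.toDual x (W.conjSelmerInfty κ γ s) := by
  rw [add_smul, one_smul, map_add, AddMonoidHom.add_apply, D.toDual_T_smul, add_sub_cancel]
  rfl

/-- **`((1+T)^k·x)(s) = x(conj_γ^k s)`** for every `k`. [cite: GreenbergLNM1716, §1 p. 60] -/
theorem toDual_one_add_X_pow_smul (k : ℕ) :
    ∀ (x : D.X) (s : W.selmerInfty κ),
      D.toDual ((1 + (X : IwasawaAlgebra p)) ^ k • x) s =
        D.toDual x (((W.conjSelmerInfty κ γ) ^ k) s) := by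
  induction k with
  | zero => intro x s; rw [pow_zero, one_smul, pow_zero, AddMonoid.End.one_apply]
  | succ k ih =>
    intro x s
    rw [pow_succ, mul_smul, ih, toDual_one_add_X_smul, pow_succ', AddMonoid.End.coe_mul,
      Function.comp_apply]

/-- **`(ω_n·x)(s) = 0`** for `ω_n = (1+T)^{pⁿ} − 1` and `s` fixed by `conj_{γ^{pⁿ}}`. [folklore] -/
theorem toDual_omega_smul_eq_zero (n : ℕ) (x : D.X) (s : W.selmerInfty κ)
    (hγs : W.conjH1 p κ.kerSubgroup (γ ^ p ^ n) (s : W.subgroupH1 p κ.kerSubgroup) = s) :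
    D.toDual (((1 + (X : IwasawaAlgebra p)) ^ p ^ n - 1) • x) s = 0 := by
  rw [sub_smul, one_smul, map_sub, AddMonoidHom.sub_apply, toDual_one_add_X_pow_smul, sub_eq_zero]
  congr 1
  exact Subtype.ext ((W.coe_conjSelmerInfty_pow_apply κ γ (p ^ n) s).trans hγs)

/-- **`(p·x)(s) = 0`** for a `p`-torsion class `s`. [folklore] -/
theorem toDual_C_p_smul_eq_zero (x : D.X) (s : W.selmerInfty κ) (hps : p • s = 0) :
    D.toDual ((C (p : ℤ_[p]) : IwasawaAlgebra p) • x) s = 0 := by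
  rw [D.toDual_C_smul (p : ℤ_[p]) x s 1 (by rw [pow_one]; exact hps)]
  have : PadicInt.toZModPow 1 (p : ℤ_[p]) = 0 := by
    rw [map_natCast, ZMod.natCast_eq_zero_iff, pow_one]
  rw [this, ZMod.val_zero, zero_smul]

/-- **`I_n X` pairs to zero with every `p`-torsion class fixed by `conj_{γ^{pⁿ}}`**, where
`I_n = (p, ω_n)`, `ω_n = (1+T)^{pⁿ} − 1` (`Submodule.smul_induction_on`; an element `u·p + v·ω_n` of
`I_n` acts as `p·(u·y) + ω_n·(v·y)`). [cite: GreenbergLNM1716, §1 p. 60] -/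
theorem toDual_apply_eq_zero_of_mem_layerIdeal_smul_top (n : ℕ) {x : D.X}
    (hx : x ∈ Ideal.span {(C (p : ℤ_[p]) : IwasawaAlgebra p),
        (1 + (X : IwasawaAlgebra p)) ^ p ^ n - 1} • (⊤ : Submodule (IwasawaAlgebra p) D.X))
    (s : W.selmerInfty κ) (hps : p • s = 0)
    (hγs : W.conjH1 p κ.kerSubgroup (γ ^ p ^ n) (s : W.subgroupH1 p κ.kerSubgroup) = s) :
    D.toDual x s = 0 := by
  refine Submodule.smul_induction_on hx (fun r hr y _ ↦ ?_) (fun y z hy hz ↦ ?_)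
  · obtain ⟨u, v, rfl⟩ := Ideal.mem_span_pair.mp hr
    rw [add_smul, map_add, AddMonoidHom.add_apply, mul_comm u, mul_comm v, mul_smul, mul_smul,
      toDual_C_p_smul_eq_zero D (u • y) s hps, toDual_omega_smul_eq_zero D n (v • y) s hγs,
      add_zero]
  · rw [map_add, AddMonoidHom.add_apply, hy, hz, add_zero]

end Pairing

/-! ## §2. `X/I_n X` is finite: `𝔪^{pⁿ + 1} ≤ I_n = (p, ω_n)` -/

section Finite

variable {p : ℕ} [hp : Fact p.Prime]

/-- `ω_n − T^{pⁿ} ∈ (p)`: `(1+T)^{pⁿ} − 1 − T^{pⁿ} = Σ_{0<k<pⁿ} binom(pⁿ,k) T^k` and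
`p ∣ binom(pⁿ, k)` (`Nat.Prime.dvd_choose_pow`). [cite: Washington1997, §13.2 (Lemma 13.15 ff.)] -/
theorem C_p_dvd_omega_sub_X_pow (n : ℕ) :
    (C (p : ℤ_[p]) : IwasawaAlgebra p) ∣
      ((1 + (X : IwasawaAlgebra p)) ^ p ^ n - 1 - (X : IwasawaAlgebra p) ^ p ^ n) := by
  rw [← Ideal.mem_span_singleton]
  change _ ∈ augIdealP p
  rw [IwasawaAlgebra.mem_augIdealP_iff]
  intro k
  have hpoly : ((1 + (X : IwasawaAlgebra p)) ^ p ^ n : IwasawaAlgebra p) =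
      (((1 + Polynomial.X) ^ p ^ n : Polynomial ℤ_[p]) : PowerSeries ℤ_[p]) := by
    rw [Polynomial.coe_pow, Polynomial.coe_add, Polynomial.coe_one, Polynomial.coe_X]
  rw [map_sub, map_sub, hpoly, Polynomial.coeff_coe, Polynomial.coeff_one_add_X_pow, coeff_X_pow,
    coeff_one]
  by_cases hk0 : k = 0
  · subst hk0
    simp [(pow_pos hp.out.pos n).ne]
  by_cases hkn : k = p ^ n
  · subst hkn
    simp [hp.out.ne_zero]
  · rw [if_neg hk0, if_neg hkn, sub_zero, sub_zero]
    exact Nat.cast_dvd_cast (hp.out.dvd_choose_pow hk0 hkn)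

/-- `𝔪 ≤ (p, T)`: an element of the maximal ideal of `Λ = ℤ_p⟦T⟧` has constant term divisible by
`p`, so it is `p·c + T·r'`. [folklore] -/
theorem maximalIdeal_le_span_C_p_X :
    maximalIdeal (IwasawaAlgebra p) ≤
      Ideal.span {(C (p : ℤ_[p]) : IwasawaAlgebra p), (X : IwasawaAlgebra p)} := by
  intro r hr
  have h0 := GeneratorCountLayerZero.toZModPow_one_constantCoeff_eq_zero_of_mem_maximalIdeal hr
  have hdvd : (p : ℤ_[p]) ∣ constantCoeff r := by
    have : constantCoeff r ∈ RingHom.ker (PadicInt.toZModPow (p := p) 1) := h0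
    rwa [PadicInt.ker_toZModPow, pow_one, Ideal.mem_span_singleton] at this
  obtain ⟨c, hc⟩ := hdvd
  have hdec := eq_X_mul_shift_add_const r -- `r = X * r' + C r(0)`
  rw [Ideal.mem_span_pair]
  refine ⟨C c, PowerSeries.mk fun i ↦ coeff (i + 1) r, ?_⟩
  conv_rhs => rw [hdec]
  rw [hc, map_mul, map_natCast]
  ring

/-- **`𝔪^{m} ≤ (p, T^m)`** for every `m`: `(p, T)^m ⊆ (p, T^m)` (`Ideal.span_pair_mul_span_pair`).
[folklore] -/
theorem maximalIdeal_pow_le_span_C_p_X_pow (m : ℕ) :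
    maximalIdeal (IwasawaAlgebra p) ^ m ≤
      Ideal.span {(C (p : ℤ_[p]) : IwasawaAlgebra p), (X : IwasawaAlgebra p) ^ m} := by
  induction m with
  | zero => rw [pow_zero, pow_zero, Ideal.one_eq_top]; exact le_of_eq (by
      symm; rw [Ideal.eq_top_iff_one]; exact Ideal.subset_span (by simp))
  | succ m ih =>
    calc maximalIdeal (IwasawaAlgebra p) ^ (m + 1)
        = maximalIdeal (IwasawaAlgebra p) ^ m * maximalIdeal (IwasawaAlgebra p) := pow_succ _ _
      _ ≤ Ideal.span {(C (p : ℤ_[p]) : IwasawaAlgebra p), (X : IwasawaAlgebra p) ^ m} *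
          Ideal.span {(C (p : ℤ_[p]) : IwasawaAlgebra p), (X : IwasawaAlgebra p)} :=
        Ideal.mul_mono ih maximalIdeal_le_span_C_p_X
      _ = Ideal.span {(C (p : ℤ_[p]) : IwasawaAlgebra p) * C (p : ℤ_[p]),
            (C (p : ℤ_[p]) : IwasawaAlgebra p) * X, (X : IwasawaAlgebra p) ^ m * C (p : ℤ_[p]),
            (X : IwasawaAlgebra p) ^ m * X} := Ideal.span_pair_mul_span_pair _ _ _ _
      _ ≤ Ideal.span {(C (p : ℤ_[p]) : IwasawaAlgebra p), (X : IwasawaAlgebra p) ^ (m + 1)} := by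
        refine Ideal.span_le.mpr ?_
        rintro z (rfl | rfl | rfl | rfl)
        · exact Ideal.mem_span_pair.mpr ⟨C (p : ℤ_[p]), 0, by ring⟩
        · exact Ideal.mem_span_pair.mpr ⟨X, 0, by ring⟩
        · exact Ideal.mem_span_pair.mpr ⟨(X : IwasawaAlgebra p) ^ m, 0, by ring⟩
        · exact Ideal.mem_span_pair.mpr ⟨0, 1, by ring⟩

/-- **`𝔪^{pⁿ} ≤ I_n = (p, ω_n)`**: `T^{pⁿ} = ω_n − (ω_n − T^{pⁿ}) ∈ I_n`. [cite: Washington1997, §13.2] -/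
theorem maximalIdeal_pow_le_layerIdeal (n : ℕ) :
    maximalIdeal (IwasawaAlgebra p) ^ p ^ n ≤
      Ideal.span {(C (p : ℤ_[p]) : IwasawaAlgebra p), (1 + (X : IwasawaAlgebra p)) ^ p ^ n - 1} := by
  refine (maximalIdeal_pow_le_span_C_p_X_pow (p ^ n)).trans (Ideal.span_le.mpr ?_)
  rintro z (rfl | rfl)
  · exact Ideal.subset_span (by simp)
  · obtain ⟨c, hc⟩ := C_p_dvd_omega_sub_X_pow (p := p) n
    rw [SetLike.mem_coe, Ideal.mem_span_pair]
    refine ⟨-c, 1, ?_⟩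
    have : (X : IwasawaAlgebra p) ^ p ^ n =
        ((1 + (X : IwasawaAlgebra p)) ^ p ^ n - 1) - (C (p : ℤ_[p]) : IwasawaAlgebra p) * c := by
      rw [← hc]; ring
    rw [this]; ring

/-- **`X/I_n X` is finite** for `X` finitely generated over `Λ`: it is a finitely generated module
over `Λ/I_n`, a quotient of the finite ring `Λ/𝔪^{pⁿ}` (tree `finite_quotient_maximalIdeal_pow`).
[cite: Washington1997, §13.2] -/
theorem finite_quotient_layerIdeal_smul_top (n : ℕ) (M : Type u) [AddCommGroup M]
    [Module (IwasawaAlgebra p) M] [Module.Finite (IwasawaAlgebra p) M] :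
    Finite (M ⧸ Ideal.span {(C (p : ℤ_[p]) : IwasawaAlgebra p),
        (1 + (X : IwasawaAlgebra p)) ^ p ^ n - 1} • (⊤ : Submodule (IwasawaAlgebra p) M)) := by
  set I := Ideal.span {(C (p : ℤ_[p]) : IwasawaAlgebra p),
    (1 + (X : IwasawaAlgebra p)) ^ p ^ n - 1} with hI
  haveI : Finite (IwasawaAlgebra p ⧸ I) := by
    haveI := finite_quotient_maximalIdeal_pow p (p ^ n)
    exact Finite.of_surjective _ (Ideal.Quotient.factor_surjective (maximalIdeal_pow_le_layerIdeal n))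
  exact Module.finite_of_finite (IwasawaAlgebra p ⧸ I)

end Finite

/-! ## §3. The count at layer `n` -/

section Count

variable {K : Type u} [Field K] [NumberField K] {W : WeierstrassCurve K} {p : ℕ} [hp : Fact p.Prime]
  {κ : ZpExtension K p} {γ : Field.absoluteGaloisGroup K} (D : W.SelmerDualData κ γ)

/-- **`#{p`-torsion `γ^{pⁿ}`-fixed classes} ≤ #(X/I_n X)`**, `I_n = (p, (1+T)^{pⁿ} − 1)`: a finite
family of DISTINCT classes `s ∈ Sel_{p^∞}(E/K_∞)` with `p·s = 0` and `conj_{γ^{pⁿ}} s = s` has at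
most `#(X/I_n X)` members, for EVERY Pontryagin-dual datum `D` over `(κ, γ)` with `X = D.X` finitely
generated: `s ↦ (x mod I_n X ↦ x(s))` is an injective map into `Hom(X/I_n X, ℚ/ℤ)` (§1; characters
separate classes, `GeneratorCountLayerZero.eq_of_forall_toDual_apply_eq`) and
`#Hom(Q, ℚ/ℤ) = #Q` for the finite group `Q = X/I_n X` (§2). The layer-`n` half of "`X/(p,ω_n)X` is
dual to `Sel[p]^{Γ_n}`". [cite: GreenbergLNM1716, §1 p. 60] -/
theorem card_le_natCard_quotient_layerIdeal [Module.Finite (IwasawaAlgebra p) D.X] (n : ℕ)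
    (t : Finset (W.selmerInfty κ))
    (ht : ∀ s ∈ t, p • s = 0 ∧
      W.conjH1 p κ.kerSubgroup (γ ^ p ^ n) (s : W.subgroupH1 p κ.kerSubgroup) = s) :
    t.card ≤ Nat.card (D.X ⧸ Ideal.span {(C (p : ℤ_[p]) : IwasawaAlgebra p),
        (1 + (X : IwasawaAlgebra p)) ^ p ^ n - 1} • (⊤ : Submodule (IwasawaAlgebra p) D.X)) := by
  set N := Ideal.span {(C (p : ℤ_[p]) : IwasawaAlgebra p),
    (1 + (X : IwasawaAlgebra p)) ^ p ^ n - 1} • (⊤ : Submodule (IwasawaAlgebra p) D.X) with hN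
  haveI : Finite (D.X ⧸ N) := finite_quotient_layerIdeal_smul_top n D.X
  haveI : Finite (CharacterModule (D.X ⧸ N)) :=
    PontryaginCard.finite_characterModule_of_finite (D.X ⧸ N)
  let f : t → CharacterModule (D.X ⧸ N) := fun s ↦
    QuotientAddGroup.lift N.toAddSubgroup (D.toDual.flip s.1) fun x hx ↦ by
      simpa using toDual_apply_eq_zero_of_mem_layerIdeal_smul_top D n hx s.1 (ht s.1 s.2).1
        (ht s.1 s.2).2
  have hf_mk : ∀ (s : t) (x : D.X), f s (Submodule.Quotient.mk x) = D.toDual x s.1 := fun _ _ ↦ rfl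
  have hf : Function.Injective f := by
    rintro ⟨s, hs⟩ ⟨s', hs'⟩ h
    refine Subtype.ext (GeneratorCountLayerZero.eq_of_forall_toDual_apply_eq D fun x ↦ ?_)
    rw [← hf_mk ⟨s, hs⟩ x, ← hf_mk ⟨s', hs'⟩ x, h]
  calc t.card = Nat.card t := (Nat.card_eq_finsetCard t).symm
    _ ≤ Nat.card (CharacterModule (D.X ⧸ N)) := Nat.card_le_card_of_injective f hf
    _ = Nat.card (D.X ⧸ N) := PontryaginCard.natCard_characterModule_of_finite _

omit [NumberField K] in
/-- `γ^{pⁿ} ∈ Gal(K̄/K_n) = κ⁻¹(pⁿ ℤ_p)` for every `γ ∈ Γ_K`. [cite: Washington1997, §13.1] -/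
theorem pow_mem_layerSubgroup (κ : ZpExtension K p) (γ : Field.absoluteGaloisGroup K) (n : ℕ) :
    γ ^ p ^ n ∈ κ.layerSubgroup n := by
  rw [ZpExtension.mem_layerSubgroup, map_pow, toAdd_pow]
  exact ⟨(κ γ).toAdd, by rw [nsmul_eq_mul, Nat.cast_pow]⟩

/-- **`#A_n[p]`-families are counted by `X/I_n X`.** For an elliptic curve `E = W` over a number
field `K` with `E(K)[p] = 0`, ANY `ℤ_p`-extension `κ`, any `γ ∈ Γ_K`, any Pontryagin-dual datum `D`
with `X = D.X` finitely generated and any layer `n`: a finite family `t` of DISTINCT `p`-torsion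
classes of `A_n = h_n⁻¹(Sel_{p^∞}(E/K_∞)) ⊆ H¹(K_n, E[p^∞])` (`selmerInftyPreimage κ n`) has
`#t ≤ #(X/I_n X)`, `I_n = (p, (1+T)^{pⁿ} − 1)`: the classes `h_n z ∈ Sel_∞` are distinct (`h_n`
injective, n1011's `Additive.layerToInfty_injective_of_no_pTorsion`), `p`-torsion, and fixed by
`conj_σ` for `σ ∈ Gal(K̄/K_n)` (tree `range_layerToInfty_le_layerInvariants_holds`), in particular
by `γ^{pⁿ}`. [cite: GreenbergLNM1716, §1 p. 60, Thm. 1.2 and §3 pp. 85–86 (Lemma 3.1)] -/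
theorem card_le_natCard_quotient_layerIdeal_of_layerClasses [W.IsElliptic]
    [Module.Finite (IwasawaAlgebra p) D.X] (hK : ∀ P : W.toAffine.Point, p • P = 0 → P = 0) (n : ℕ)
    (t : Finset {z : W.selmerInftyPreimage κ n // p • z = 0}) :
    t.card ≤ Nat.card (D.X ⧸ Ideal.span {(C (p : ℤ_[p]) : IwasawaAlgebra p),
        (1 + (X : IwasawaAlgebra p)) ^ p ^ n - 1} • (⊤ : Submodule (IwasawaAlgebra p) D.X)) := by
  let g : {z : W.selmerInftyPreimage κ n // p • z = 0} → W.selmerInfty κ :=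
    fun z ↦ ⟨W.layerToInfty κ n (z.1 : W.subgroupH1 p (κ.layerSubgroup n)), z.1.2⟩
  have hg_coe : ∀ z, ((g z : W.selmerInfty κ) : W.subgroupH1 p κ.kerSubgroup) =
      W.layerToInfty κ n (z.1 : W.subgroupH1 p (κ.layerSubgroup n)) := fun _ ↦ rfl
  have hg : Function.Injective g := by
    intro z z' h
    have h' := congrArg (fun s : W.selmerInfty κ ↦ (s : W.subgroupH1 p κ.kerSubgroup)) h
    simp only [hg_coe] at h'
    exact Subtype.ext (Subtype.ext (Additive.layerToInfty_injective_of_no_pTorsion W κ hK n h'))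
  rw [← Finset.card_map ⟨g, hg⟩]
  refine card_le_natCard_quotient_layerIdeal D n _ fun s hs ↦ ?_
  obtain ⟨z, -, rfl⟩ := Finset.mem_map.mp hs
  refine ⟨?_, ?_⟩
  · apply Subtype.ext
    have hz : ((p • z.1 : W.selmerInftyPreimage κ n) : W.subgroupH1 p (κ.layerSubgroup n)) = 0 := by
      rw [z.2]; rfl
    change p • W.layerToInfty κ n (z.1 : W.subgroupH1 p (κ.layerSubgroup n)) = 0
    rw [← map_nsmul, ← AddSubgroup.coe_nsmul, hz, map_zero]
  · have hmem : W.layerToInfty κ n (z.1 : W.subgroupH1 p (κ.layerSubgroup n)) ∈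
        W.layerInvariants κ n :=
      W.range_layerToInfty_le_layerInvariants_holds κ n ⟨_, rfl⟩
    rw [mem_layerInvariants_iff] at hmem
    exact hmem _ (pow_mem_layerSubgroup κ γ n)

end Count

end Summit.BirchSwinnertonDyer.Rank1Residual.X1.GeneratorCountLayer

end
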